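import Summits.Ventures.CertifiedManyBodySolver.Transport.LTIPrimalHubbardChainEnt
import HarnessLib

/-!
# Ventures/CertifiedManyBodySolver — Transport/LTIPrimalHubbardChainTLM.lean

Speedrun cell sr-mbsolver — LIT team (lit-1 gen-6), D-19 r115 (3): the objective `h_avg` and the density row `n_avg` of op-08's
formulation-B problem files (`code/oplayer/tl_marginal.py`, kind `tl_marginal`) as window observables, and their expectations under the
local-translation-invariance (LTI) row of the lane-B by-value node.
HONEST FRAMING: first certified bounds; not a superconductivity verdict; every number certified or labelled float.

A `tl_marginal` problem on `k = n + 3` consecutive sites (`meta.model`: `t`, `U`, `mu = 0`, `filling`; `h_bond` = the BOND-centred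
density `-t Σ_σ (c†_{x σ} c_{x+1,σ} + c†_{x+1,σ} c_{x σ}) + (U/2)(n_{x↑}n_{x↓} + n_{x+1,↑}n_{x+1,↓})`, `tlmBond`) minimises
`Tr(ρ_k h_avg)`, `h_avg = (k-1)⁻¹ Σ_{bonds of the window} h_bond` (`tlmObjective`), subject to (among the rows of THEOREM B0) ONE density row
`Tr(ρ_k n_avg) = filling`, `n_avg = k⁻¹ Σ_{x,σ} n_{xσ}` (`tlmDensity`). Under the LTI row every translate of an even two-site observable has
the same expectation (`trace_toSpin_translate_eq_of_lti`, `Transport/LTIPrimalHubbardChainEnt.lean`), hence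
`⟨h_avg⟩ = ⟨h_bond(-1,0)⟩ = ⟨U n_{-1↑}n_{-1↓} − t B(-1,0)⟩ = ⟨Γ(incl) E_Φ⟩` (`trace_tlmObjective_eq_of_lti`, via
`trace_meanEnergy_eq_bond_of_lti`) and `⟨n_avg⟩ = Σ_σ ⟨n_{0σ}⟩` (`trace_tlmDensity_eq_of_lti`). The Jordan–Wigner / occupation-basis
convention of `code/oplayer/fockspace.py` agrees with the tree's (`siteOcc`, site-major strings): by-value check
HOME/sr-mbsolver-lit-1/evidence/fock_h_diff/ (all twelve one-letter matrices on three sites, the bond operator at U = 1,2,4,6,8, the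
sectors; digit order `j(n) = (n&3)·4 + (n>>2)`).
[cite: KullEtAl2024, §II.B, §VI.B] [cite: Han2020Bootstrap, §2] [cite: BratteliKishimotoRobinson1978, §3]
-/

noncomputable section

open Matrix Complex Filter Topology
open scoped ComplexOrder
open Literature.Probability.LatticeModels
open Literature.MathematicalPhysics.QuantumLattice
open Literature.MathematicalPhysics.QuantumLattice.HubbardWave0
open Literature.MathematicalPhysics.QuantumLattice.ThermodynamicLimit
open Literature.MathematicalPhysics.QuantumLattice.JordanWigner
open Literature.MathematicalPhysics.QuantumManyBody.StateRelaxation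
open Literature.InformationTheory.Entropy (vonNeumannEntropy)

namespace Summit.Ventures.CertifiedManyBodySolver.Transport

/-! ### The `tl_marginal` objective `h_avg` and density `n_avg` on the canonical window `{-1, …, n+1}` -/

section Defs

/-- **The bond-centred Hubbard chain density** `h_bond(x,y) = -t Σ_σ (c†_{xσ} c_{yσ} + c†_{yσ} c_{xσ}) + (U/2)(n_{x↑}n_{x↓} +
n_{y↑}n_{y↓})` of `tl_marginal.chain_bond_density(form='bond')` (μ = 0). [cite: KullEtAl2024, §II.B] -/
def tlmBond (t U : ℝ) {Λ' : Finset (Site 1)} (x y : Site 1) (hx : x ∈ Λ') (hy : y ∈ Λ') : FermionOp Λ' :=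
  (-(t : ℂ)) • ∑ σ : Fin 2, ((cAt x hx σ)ᴴ * cAt y hy σ + (cAt y hy σ)ᴴ * cAt x hx σ) +
    ((U / 2 : ℝ) : ℂ) • (nAt x hx 0 * nAt x hx 1 + nAt y hy 0 * nAt y hy 1)

/-- The `j`-th site of the canonical window, `x_j = j - 1` (`j = 0, …, n+2`). [folklore] -/
def tlmSite (j : ℕ) : Site 1 := fun _ => (j : ℤ) - 1

/-- `x_j ∈ {-1, …, n+1}` for `j ≤ n + 2`. [folklore] -/
theorem tlmSite_mem {n j : ℕ} (hj : j ≤ n + 2) : tlmSite j ∈ chainWindow (-1) ((n : ℤ) + 1) := by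
  simp only [mem_chainWindow, tlmSite]
  omega

/-- **`h_avg`**: the average of `h_bond` over the `n + 2` bonds `(x_j, x_{j+1})` of the window `{-1, …, n+1}` — the objective of a
`tl_marginal` problem on `k = n + 3` sites. [cite: KullEtAl2024, §II.B] -/
def tlmObjective (t U : ℝ) (n : ℕ) : FermionOp (chainWindow (-1) ((n : ℤ) + 1)) :=
  ((1 / ((n : ℝ) + 2) : ℝ) : ℂ) • ∑ j : Fin (n + 2),
    tlmBond t U (tlmSite (j : ℕ)) (tlmSite ((j : ℕ) + 1)) (tlmSite_mem (by omega)) (tlmSite_mem (by omega))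

/-- **`n_avg`**: the site-averaged total density `k⁻¹ Σ_{x,σ} n_{xσ}` of the window — the density row of a `tl_marginal` problem
(`Tr(ρ_k n_avg) = filling`). [cite: KullEtAl2024, §II.B] -/
def tlmDensity (n : ℕ) : FermionOp (chainWindow (-1) ((n : ℤ) + 1)) :=
  ((1 / ((n : ℝ) + 3) : ℝ) : ℂ) • ∑ p : PolySite (chainWindow (-1) ((n : ℤ) + 1)), ∑ σ : Fin 2, numberOp p σ

end Defs

/-! ### `⟨h_avg⟩ = ⟨Γ(incl) E_Φ⟩` and `⟨n_avg⟩ = Σ_σ ⟨n_{0σ}⟩` under the LTI row -/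

section Bridge

variable (n : ℕ)

/-- `{-1, 0} ⊆ {-1, …, n+1}`. [folklore] -/
theorem tlm_pair_subset : chainWindow (-1) 0 ⊆ chainWindow (-1) ((n : ℤ) + 1) := chainWindow_mono_right (-1) (by omega)

/-- `{-1, 0} + c ⊆ {-1, …, n+1}` for `c ≤ n + 1`. [folklore] -/
theorem tlm_pair_shift_subset {c : ℕ} (hc : c ≤ n + 1) :
    affShiftSet 1 (fun _ => (c : ℤ)) (chainWindow (-1) 0) ⊆ chainWindow (-1) ((n : ℤ) + 1) := by
  intro x hx
  obtain ⟨y, hy, rfl⟩ := Finset.mem_map.1 hx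
  rw [mem_chainWindow] at hy
  rw [mem_chainWindow]
  simp only [Function.Embedding.coeFn_mk, affSite_apply, Units.val_one, one_mul]
  omega

/-- `-1 ∈ {-1, 0}`, `0 ∈ {-1, 0}`. [folklore] -/
theorem tlm_neg_mem_pair : (-unitVec 0 : Site 1) ∈ chainWindow (-1) 0 := by
  simp only [mem_chainWindow, Pi.neg_apply, unitVec, Pi.single_eq_same]
  omega

/-- `0 ∈ {-1, 0}`. [folklore] -/
theorem tlm_zero_mem_pair : (0 : Site 1) ∈ chainWindow (-1) 0 := by
  simp only [mem_chainWindow, Pi.zero_apply]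
  omega

/-- The translate by `c` of the generators of `𝔄_{\{-1,0\}}`: `Γ(τ_c) c_{-1,σ} = c_{x_c, σ}`, `Γ(τ_c) c_{0,σ} = c_{x_{c+1}, σ}`
(`x_j = j - 1`). [folklore] -/
theorem fermionEmbed_pair_shift_cAt {c : ℕ} (hc : c ≤ n + 1) (σ : Fin 2) :
    fermionEmbed ((PolySite.affEmb 1 (fun _ => (c : ℤ)) (chainWindow (-1) 0)).trans (PolySite.incl (tlm_pair_shift_subset n hc)))
        (cAt (-unitVec 0) tlm_neg_mem_pair σ) = cAt (tlmSite c) (tlmSite_mem (by omega)) σ ∧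
      fermionEmbed ((PolySite.affEmb 1 (fun _ => (c : ℤ)) (chainWindow (-1) 0)).trans (PolySite.incl (tlm_pair_shift_subset n hc)))
        (cAt 0 tlm_zero_mem_pair σ) = cAt (tlmSite (c + 1)) (tlmSite_mem (by omega)) σ := by
  have e1 : affSite 1 (fun _ => (c : ℤ)) (-unitVec 0 : Site 1) = tlmSite c := by
    funext i
    rw [Subsingleton.elim i 0, affSite_apply, Units.val_one, one_mul, tlmSite]
    simp [unitVec]
    ring
  have e2 : affSite 1 (fun _ => (c : ℤ)) (0 : Site 1) = tlmSite (c + 1) := by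
    funext i
    rw [Subsingleton.elim i 0, affSite_apply, Units.val_one, one_mul, tlmSite, Pi.zero_apply]
    push_cast
    ring
  constructor
  · rw [← fermionEmbed_fermionEmbed, fermionEmbed_affEmb_one_cAt, fermionEmbed_incl_cAt]
    exact cAt_congr _ _ e1 σ
  · rw [← fermionEmbed_fermionEmbed, fermionEmbed_affEmb_one_cAt, fermionEmbed_incl_cAt]
    exact cAt_congr _ _ e2 σ

/-- The translate by `c` of the densities of `𝔄_{\{-1,0\}}`: `Γ(τ_c) n_{-1,σ} = n_{x_c, σ}`, `Γ(τ_c) n_{0,σ} = n_{x_{c+1}, σ}`.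
[folklore] -/
theorem fermionEmbed_pair_shift_nAt {c : ℕ} (hc : c ≤ n + 1) (σ : Fin 2) :
    fermionEmbed ((PolySite.affEmb 1 (fun _ => (c : ℤ)) (chainWindow (-1) 0)).trans (PolySite.incl (tlm_pair_shift_subset n hc)))
        (nAt (-unitVec 0) tlm_neg_mem_pair σ) = nAt (tlmSite c) (tlmSite_mem (by omega)) σ ∧
      fermionEmbed ((PolySite.affEmb 1 (fun _ => (c : ℤ)) (chainWindow (-1) 0)).trans (PolySite.incl (tlm_pair_shift_subset n hc)))
        (nAt 0 tlm_zero_mem_pair σ) = nAt (tlmSite (c + 1)) (tlmSite_mem (by omega)) σ := by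
  have e1 : affSite 1 (fun _ => (c : ℤ)) (-unitVec 0 : Site 1) = tlmSite c := by
    funext i
    rw [Subsingleton.elim i 0, affSite_apply, Units.val_one, one_mul, tlmSite]
    simp [unitVec]
    ring
  have e2 : affSite 1 (fun _ => (c : ℤ)) (0 : Site 1) = tlmSite (c + 1) := by
    funext i
    rw [Subsingleton.elim i 0, affSite_apply, Units.val_one, one_mul, tlmSite, Pi.zero_apply]
    push_cast
    ring
  constructor
  · rw [← fermionEmbed_fermionEmbed, fermionEmbed_affEmb_one_nAt, fermionEmbed_incl_nAt]
    exact congrArg (fun q : PolySite (chainWindow (-1) ((n : ℤ) + 1)) => numberOp q σ) (Subtype.ext (congrArg toLex e1))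
  · rw [← fermionEmbed_fermionEmbed, fermionEmbed_affEmb_one_nAt, fermionEmbed_incl_nAt]
    exact congrArg (fun q : PolySite (chainWindow (-1) ((n : ℤ) + 1)) => numberOp q σ) (Subtype.ext (congrArg toLex e2))

/-- `n_{x_0, σ} = n_{-1, σ}` and `n_{x_1, σ} = n_{0, σ}` (the same sites, other membership witnesses). [folklore] -/
theorem nAt_tlmSite_zero_one (σ : Fin 2) :
    (nAt (tlmSite 0) (tlmSite_mem (by omega : 0 ≤ n + 2)) σ : FermionOp (chainWindow (-1) ((n : ℤ) + 1))) =
        nAt (-unitVec 0) ((tlm_pair_subset n) tlm_neg_mem_pair) σ ∧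
      (nAt (tlmSite 1) (tlmSite_mem (by omega : 1 ≤ n + 2)) σ : FermionOp (chainWindow (-1) ((n : ℤ) + 1))) =
        nAt 0 ((tlm_pair_subset n) tlm_zero_mem_pair) σ := by
  have e0 : tlmSite 0 = (-unitVec 0 : Site 1) := by
    funext i
    rw [Subsingleton.elim i 0, tlmSite]
    simp [unitVec]
  have e1 : tlmSite 1 = (0 : Site 1) := by
    funext i
    rw [Subsingleton.elim i 0, tlmSite, Pi.zero_apply]
    simp
  exact ⟨congrArg (fun q : PolySite (chainWindow (-1) ((n : ℤ) + 1)) => numberOp q σ) (Subtype.ext (congrArg toLex e0)),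
    congrArg (fun q : PolySite (chainWindow (-1) ((n : ℤ) + 1)) => numberOp q σ) (Subtype.ext (congrArg toLex e1))⟩

/-- `n_{xσ} = c†_{xσ} c_{xσ}` through `cAt`. [folklore] -/
theorem nAt_eq_cAt {Λ : Finset (Site 1)} (x : Site 1) (hx : x ∈ Λ) (σ : Fin 2) :
    nAt x hx σ = (cAt x hx σ)ᴴ * cAt x hx σ := by
  rw [nAt, numberOp, cAt, annihilation_conjTranspose]

/-- **The translate by `c` of the bond density of `{-1, 0}` is the bond density of `(x_c, x_{c+1})`.** [folklore] -/
theorem fermionEmbed_pair_shift_tlmBond (t U : ℝ) {c : ℕ} (hc : c ≤ n + 1) :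
    fermionEmbed ((PolySite.affEmb 1 (fun _ => (c : ℤ)) (chainWindow (-1) 0)).trans (PolySite.incl (tlm_pair_shift_subset n hc)))
        (tlmBond t U (-unitVec 0) 0 tlm_neg_mem_pair tlm_zero_mem_pair) =
      tlmBond t U (tlmSite c) (tlmSite (c + 1)) (tlmSite_mem (by omega)) (tlmSite_mem (by omega)) := by
  have hc' := fun σ => (fermionEmbed_pair_shift_cAt n hc σ).1
  have hc'' := fun σ => (fermionEmbed_pair_shift_cAt n hc σ).2
  simp only [tlmBond, nAt_eq_cAt, fermionEmbed_add, fermionEmbed_smul, fermionEmbed_sum, fermionEmbed_mul,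
    fermionEmbed_conjTranspose, hc', hc'']

/-- The bond density is even. [cite: ArakiMoriya2003, §4.1] -/
theorem parityAut_tlmBond (t U : ℝ) {Λ : Finset (Site 1)} (x y : Site 1) (hx : x ∈ Λ) (hy : y ∈ Λ) :
    parityAut (tlmBond t U x y hx hy) = tlmBond t U x y hx hy := by
  simp only [tlmBond, map_add, map_smul, map_sum, map_mul, parityAut_nAt, cAt, annihilation_conjTranspose, parityAut_creation,
    parityAut_annihilation, neg_mul_neg]

/-- **`⟨h_bond(x_c, x_{c+1})⟩ = ⟨h_bond(-1, 0)⟩` in an LTI window state.** [cite: KullEtAl2024, §II.B eq. (locTIn)] -/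
theorem trace_tlmBond_eq_of_lti (t U : ℝ) {c : ℕ} (hc : c ≤ n + 1)
    {ρ : Op (PolySite (chainWindow (-1) ((n : ℤ) + 1))) 4}
    (hLTI : spinPartialTrace ((PolySite.affEmb 1 (unitVec 0) (chainWindow (-1) (n : ℤ))).trans
        (PolySite.incl (affShiftSet_chainWindow_subset (-1) (n : ℤ)))) ρ =
      spinPartialTrace (PolySite.incl (chainWindow_mono_right (-1) (by omega : (n : ℤ) ≤ n + 1))) ρ) :
    (toSpin (tlmBond t U (tlmSite c) (tlmSite (c + 1)) (tlmSite_mem (by omega)) (tlmSite_mem (by omega))) * ρ).trace =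
      (toSpin (tlmBond t U (-unitVec 0) 0 ((tlm_pair_subset n) tlm_neg_mem_pair) ((tlm_pair_subset n) tlm_zero_mem_pair)) *
        ρ).trace := by
  have h := trace_toSpin_translate_eq_of_lti n (fun _ => (c : ℤ)) (tlm_pair_shift_subset n hc) (tlm_pair_subset n) rfl hLTI
    (parityAut_tlmBond t U (-unitVec 0) 0 tlm_neg_mem_pair tlm_zero_mem_pair)
  rw [fermionEmbed_pair_shift_tlmBond n t U hc] at h
  rw [h]
  have e : fermionEmbed (PolySite.incl (tlm_pair_subset n)) (tlmBond t U (-unitVec 0) 0 tlm_neg_mem_pair tlm_zero_mem_pair) =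
      tlmBond t U (-unitVec 0) 0 ((tlm_pair_subset n) tlm_neg_mem_pair) ((tlm_pair_subset n) tlm_zero_mem_pair) := by
    simp only [tlmBond, nAt_eq_cAt, fermionEmbed_add, fermionEmbed_smul, fermionEmbed_sum, fermionEmbed_mul,
      fermionEmbed_conjTranspose, fermionEmbed_incl_cAt]
  rw [e]

/-- **`⟨n_{x_c, σ}⟩ = ⟨n_{-1, σ}⟩` in an LTI window state** (`c ≤ n + 2`). [cite: KullEtAl2024, §II.B eq. (locTIn)] -/
theorem trace_nAt_eq_of_lti {c : ℕ} (hc : c ≤ n + 2) (σ : Fin 2)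
    {ρ : Op (PolySite (chainWindow (-1) ((n : ℤ) + 1))) 4}
    (hLTI : spinPartialTrace ((PolySite.affEmb 1 (unitVec 0) (chainWindow (-1) (n : ℤ))).trans
        (PolySite.incl (affShiftSet_chainWindow_subset (-1) (n : ℤ)))) ρ =
      spinPartialTrace (PolySite.incl (chainWindow_mono_right (-1) (by omega : (n : ℤ) ≤ n + 1))) ρ) :
    (toSpin (nAt (tlmSite c) (tlmSite_mem hc) σ) * ρ).trace =
      (toSpin (nAt (-unitVec 0) ((tlm_pair_subset n) tlm_neg_mem_pair) σ) * ρ).trace := by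
  -- `⟨n_{0σ}⟩ = ⟨n_{-1σ}⟩`: the unit translate of `n_{-1σ}`
  have h01 : (toSpin (nAt 0 ((tlm_pair_subset n) tlm_zero_mem_pair) σ) * ρ).trace =
      (toSpin (nAt (-unitVec 0) ((tlm_pair_subset n) tlm_neg_mem_pair) σ) * ρ).trace := by
    have h2 := trace_toSpin_translate_eq_of_lti n (fun _ => ((1 : ℕ) : ℤ)) (tlm_pair_shift_subset n (by omega : 1 ≤ n + 1))
      (tlm_pair_subset n) (c := 1) rfl hLTI (parityAut_nAt (-unitVec 0) tlm_neg_mem_pair σ)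
    rw [(fermionEmbed_pair_shift_nAt n (by omega : 1 ≤ n + 1) σ).1, fermionEmbed_incl_nAt, (nAt_tlmSite_zero_one n σ).2] at h2
    exact h2
  rcases Nat.eq_zero_or_pos c with rfl | hpos
  · rw [(nAt_tlmSite_zero_one n σ).1]
  · obtain ⟨c', rfl⟩ : ∃ c', c = c' + 1 := ⟨c - 1, by omega⟩
    have hc' : c' ≤ n + 1 := by omega
    have h1 := trace_toSpin_translate_eq_of_lti n (fun _ => (c' : ℤ)) (tlm_pair_shift_subset n hc') (tlm_pair_subset n) rfl hLTI
      (parityAut_nAt 0 tlm_zero_mem_pair σ)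
    rw [(fermionEmbed_pair_shift_nAt n hc' σ).2, fermionEmbed_incl_nAt] at h1
    rw [h1, h01]

/-- **`⟨h_avg⟩ = ⟨Γ(incl) E_Φ⟩` in an LTI window state**: the `tl_marginal` objective and the objective of the by-value node of
THEOREM B0 / ENT-B0 have the same expectation in every window state satisfying the local-translation-invariance row.
[cite: KullEtAl2024, §II.B eq. (locTIn)] [cite: BratteliKishimotoRobinson1978, §3] -/
theorem trace_tlmObjective_eq_of_lti (t U : ℝ)
    {ρ : Op (PolySite (chainWindow (-1) ((n : ℤ) + 1))) 4}
    (hLTI : spinPartialTrace ((PolySite.affEmb 1 (unitVec 0) (chainWindow (-1) (n : ℤ))).trans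
        (PolySite.incl (affShiftSet_chainWindow_subset (-1) (n : ℤ)))) ρ =
      spinPartialTrace (PolySite.incl (chainWindow_mono_right (-1) (by omega : (n : ℤ) ≤ n + 1))) ρ) :
    (toSpin (tlmObjective t U n) * ρ).trace =
      (toSpin (fermionEmbed (PolySite.incl (thicken_zero_one_subset_chainWindow (by omega : (1 : ℤ) ≤ n + 1)))
        ((hubbardFermionInteraction 1 t U).meanEnergyObs 1)) * ρ).trace := by
  -- every bond has the expectation of the first bond
  have hb : ∀ j : Fin (n + 2),
      (toSpin (tlmBond t U (tlmSite (j : ℕ)) (tlmSite ((j : ℕ) + 1)) (tlmSite_mem (by omega)) (tlmSite_mem (by omega))) * ρ).trace =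
        (toSpin (tlmBond t U (-unitVec 0) 0 ((tlm_pair_subset n) tlm_neg_mem_pair) ((tlm_pair_subset n) tlm_zero_mem_pair)) *
          ρ).trace :=
    fun j => trace_tlmBond_eq_of_lti n t U (by omega) hLTI
  have hsum : (toSpin (tlmObjective t U n) * ρ).trace =
      (toSpin (tlmBond t U (-unitVec 0) 0 ((tlm_pair_subset n) tlm_neg_mem_pair) ((tlm_pair_subset n) tlm_zero_mem_pair)) *
        ρ).trace := by
    rw [tlmObjective, map_smul, map_sum, Matrix.smul_mul, Finset.sum_mul, trace_smul, trace_sum]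
    simp_rw [hb]
    rw [Finset.sum_const, Finset.card_univ, Fintype.card_fin, smul_eq_mul, nsmul_eq_mul]
    have hne : ((n : ℂ) + 2) ≠ 0 := by
      have : ((n : ℝ) + 2) ≠ 0 := by positivity
      exact_mod_cast this
    push_cast
    field_simp
  -- the first bond versus the mean-energy observable: `⟨D_0⟩ = ⟨D_{-1}⟩`
  obtain ⟨hE, -⟩ := trace_meanEnergy_eq_bond_of_lti t U (chainWindow_mono_right (-1) (by omega : (n : ℤ) ≤ n + 1))
    (affShiftSet_chainWindow_subset (-1) (n : ℤ)) (thicken_zero_one_subset_chainWindow (by omega : (1 : ℤ) ≤ n + 1))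
    (by simp only [mem_chainWindow, Pi.neg_apply, unitVec, Pi.single_eq_same]; omega)
    (zero_mem_chainWindow (by omega)) (isLowerSet_range_incl_chainWindow _) (strictMono_affEmb_trans_incl _)
    (ordConnected_range_affEmb_trans_incl (n : ℤ) _) hLTI
  have hD : (toSpin (nAt 0 ((tlm_pair_subset n) tlm_zero_mem_pair) 0 * nAt 0 ((tlm_pair_subset n) tlm_zero_mem_pair) 1) * ρ).trace =
      (toSpin (nAt (-unitVec 0) ((tlm_pair_subset n) tlm_neg_mem_pair) 0 * nAt (-unitVec 0) ((tlm_pair_subset n) tlm_neg_mem_pair) 1) *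
        ρ).trace := by
    have hev : parityAut (nAt (-unitVec 0) tlm_neg_mem_pair 0 * nAt (-unitVec 0) tlm_neg_mem_pair 1 : FermionOp (chainWindow (-1) 0)) =
        nAt (-unitVec 0) tlm_neg_mem_pair 0 * nAt (-unitVec 0) tlm_neg_mem_pair 1 := by
      rw [map_mul, parityAut_nAt, parityAut_nAt]
    have h := trace_toSpin_translate_eq_of_lti n (fun _ => ((1 : ℕ) : ℤ)) (tlm_pair_shift_subset n (by omega : 1 ≤ n + 1))
      (tlm_pair_subset n) (c := 1) rfl hLTI hev
    rw [fermionEmbed_mul, fermionEmbed_mul, (fermionEmbed_pair_shift_nAt n (by omega : 1 ≤ n + 1) 0).1,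
      (fermionEmbed_pair_shift_nAt n (by omega : 1 ≤ n + 1) 1).1, fermionEmbed_incl_nAt, fermionEmbed_incl_nAt,
      (nAt_tlmSite_zero_one n 0).2, (nAt_tlmSite_zero_one n 1).2] at h
    exact h
  rw [hsum, hE, tlmBond]
  simp only [map_add, map_smul, Matrix.add_mul, Matrix.smul_mul, trace_add, trace_smul, smul_eq_mul, hD]
  push_cast
  ring

/-- **`⟨n_avg⟩ = Σ_σ ⟨n_{0σ}⟩` in an LTI window state.** [cite: KullEtAl2024, §II.B eq. (locTIn)] -/
theorem trace_tlmDensity_eq_of_lti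
    {ρ : Op (PolySite (chainWindow (-1) ((n : ℤ) + 1))) 4}
    (hLTI : spinPartialTrace ((PolySite.affEmb 1 (unitVec 0) (chainWindow (-1) (n : ℤ))).trans
        (PolySite.incl (affShiftSet_chainWindow_subset (-1) (n : ℤ)))) ρ =
      spinPartialTrace (PolySite.incl (chainWindow_mono_right (-1) (by omega : (n : ℤ) ≤ n + 1))) ρ) :
    (toSpin (tlmDensity n) * ρ).trace =
      ∑ σ : Fin 2, (toSpin (nAt 0 (zero_mem_chainWindow (by omega : (0 : ℤ) ≤ n + 1)) σ) * ρ).trace := by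
  -- every site density has the expectation of `n_{-1,σ}`
  have hx : ∀ (p : PolySite (chainWindow (-1) ((n : ℤ) + 1))) (σ : Fin 2),
      (toSpin (numberOp p σ) * ρ).trace = (toSpin (nAt (-unitVec 0) ((tlm_pair_subset n) tlm_neg_mem_pair) σ) * ρ).trace := by
    intro p σ
    have hp := mem_chainWindow.1 (PolySite.ofLex_mem p)
    obtain ⟨c, hc, hpc⟩ : ∃ c : ℕ, c ≤ n + 2 ∧ ofLex p.1 0 = (c : ℤ) - 1 :=
      ⟨(ofLex p.1 0 + 1).toNat, by omega, by omega⟩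
    have e : p = PolySite.pt (tlmSite c) (tlmSite_mem hc) := polySite_eq_of_coord_eq (by rw [PolySite.ofLex_coe_pt, tlmSite, hpc])
    rw [e]
    exact trace_nAt_eq_of_lti n hc σ hLTI
  have hcard : (Fintype.card (PolySite (chainWindow (-1) ((n : ℤ) + 1))) : ℂ) = (n : ℂ) + 3 := by
    have h1 : Fintype.card (PolySite (chainWindow (-1) ((n : ℤ) + 1))) = (chainWindow (-1) ((n : ℤ) + 1)).card := by
      rw [Fintype.card_coe, lexSites, Finset.card_map]
    have h2 : (chainWindow (-1) ((n : ℤ) + 1)).card = n + 3 := by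
      rw [chainWindow, Finset.card_map, Int.card_Icc]
      omega
    rw [h1, h2]
    push_cast
    ring
  have hne : ((n : ℂ) + 3) ≠ 0 := by
    have : ((n : ℝ) + 3) ≠ 0 := by positivity
    exact_mod_cast this
  have hL : (toSpin (tlmDensity n) * ρ).trace = ((1 / ((n : ℝ) + 3) : ℝ) : ℂ) *
      ∑ p : PolySite (chainWindow (-1) ((n : ℤ) + 1)), ∑ σ : Fin 2, (toSpin (numberOp p σ) * ρ).trace := by
    simp only [tlmDensity, map_smul, map_sum, Matrix.smul_mul, Finset.sum_mul, trace_smul, trace_sum, smul_eq_mul]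
  have hS : ∑ p : PolySite (chainWindow (-1) ((n : ℤ) + 1)), ∑ σ : Fin 2, (toSpin (numberOp p σ) * ρ).trace =
      ∑ _p : PolySite (chainWindow (-1) ((n : ℤ) + 1)), ∑ σ : Fin 2,
        (toSpin (nAt (-unitVec 0) ((tlm_pair_subset n) tlm_neg_mem_pair) σ) * ρ).trace :=
    Finset.sum_congr rfl fun p _ => Finset.sum_congr rfl fun σ _ => hx p σ
  have h0 : ∀ σ : Fin 2, (toSpin (nAt 0 (zero_mem_chainWindow (by omega : (0 : ℤ) ≤ n + 1)) σ) * ρ).trace =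
      (toSpin (nAt (-unitVec 0) ((tlm_pair_subset n) tlm_neg_mem_pair) σ) * ρ).trace := by
    intro σ
    rw [← (nAt_tlmSite_zero_one n σ).2]
    exact trace_nAt_eq_of_lti n (by omega : 1 ≤ n + 2) σ hLTI
  rw [hL, hS, Finset.sum_const, Finset.card_univ, nsmul_eq_mul, hcard, Finset.sum_congr rfl fun σ _ => h0 σ]
  push_cast
  field_simp

end Bridge

end Summit.Ventures.CertifiedManyBodySolver.Transport
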